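import Summits.CriticalPhenomena.PercolationContinuityZ3.Theorems.PercNearOneGluingNoHeavyLowerTailMajorityGluingQCertSym3Count
import HarnessLib

/-!
# Symmetrised DEGREE-3 certificates checked IN PARTS (lane prim-rate, constants-miner 1, gen 36; NEXT-g37 item 1)

Support file for the closed crux `NoHeavyLowerTail` (stmt-CriticalPhenomena-4575), majority-gluing line; the cubic copy of `…MajorityGluingQCertSymParts` (whose `aggr` /
`evalC_aggr` it reuses): `SymCert3.digest3 = aggr ∘ msort2 ∘ contribs3S`, `SymCert3.concat`, `evalC_digest3` / `evalC_concat3`, **`pos_of_digests3`** (parts' digests stated as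
data and verified separately; `runsOK` of the glued digests ⟹ the whole cubic contribution list is `≥ 0` at every nonnegative valuation) and `cut_of_digests3_count`.  No sorries.
-/

namespace Summit.CriticalPhenomena.PercolationContinuityZ3.Theorems

namespace HubOnly
namespace QCert

/-! ### Digests and gluing of parts -/

namespace SymCert3

/-- **The digest of a (partial) cubic certificate:** its key-sorted contribution list with equal keys summed. -/
def digest3 (c : SymCert3) (fuel : ℕ) : List (ℕ × ℤ) := aggr (msort2 fuel c.contribs3S)

/-- The digest evaluates like the contribution list. -/
theorem evalC_digest3 (c : SymCert3) (fuel : ℕ) (val : ℕ → ℝ) : evalC val (c.digest3 fuel) = evalC val c.contribs3S := by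
  unfold digest3; rw [evalC_aggr, evalC_perm val (msort2_perm fuel _)]

/-- Gluing two parts with the same cell parameters: concatenated entry lists on the base of the first. -/
def append (c d : SymCert3) : SymCert3 := ⟨c.base, c.ell2 ++ d.ell2, c.lin ++ d.lin, c.rows ++ d.rows, c.sqs ++ d.sqs⟩

/-- **Gluing a list of parts** on a common base. -/
def concat (b : Cert) : List SymCert3 → SymCert3
  | [] => ⟨b, [], [], [], []⟩
  | d :: l => d.append (concat b l)

/-- The base of a concatenation. -/
theorem concat_base (b : Cert) : ∀ l : List SymCert3, (∀ d ∈ l, d.base = b) → (concat b l).base = b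
  | [], _ => rfl
  | d :: l, h => by unfold concat append; exact h d (by simp)

/-- Two certificates with the same base have the same entry-contribution maps. -/
theorem contribs3S_eq_of_base (c : SymCert3) (b : Cert) (hb : c.base = b) (ell2 : List (ℕ × ℕ × ℕ)) (lin : List (ℕ × ℕ × ℕ × ℕ))
    (rows : List (List RowE3)) (sqs : List (List SqE3)) :
    (⟨b, ell2, lin, rows, sqs⟩ : SymCert3).contribs3S =
      (ell2.map c.ell2C).flatten ++ (lin.map c.linC3).flatten ++ (rows.map fun ch => (ch.map c.rowC3S).flatten).flatten ++
        (sqs.map fun ch => (ch.map c.sqC3S).flatten).flatten := by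
  subst hb; rfl

/-- **Gluing two parts adds their values** (same base). -/
theorem evalC_appendS3 (c d : SymCert3) (h : d.base = c.base) (val : ℕ → ℝ) :
    evalC val (c.append d).contribs3S = evalC val c.contribs3S + evalC val d.contribs3S := by
  cases d with
  | mk base ell2 lin rows sqs =>
    simp only at h
    subst h
    unfold append
    rw [contribs3S_eq_of_base c c.base rfl (c.ell2 ++ ell2), contribs3S_eq_of_base c c.base rfl ell2]
    unfold contribs3S
    simp only [List.map_append, List.flatten_append, QCert.evalC_append]
    ring

/-- **The glued certificate evaluates to the sum of its parts** (common base). -/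
theorem evalC_concat3 (b : Cert) (val : ℕ → ℝ) :
    ∀ l : List SymCert3, (∀ d ∈ l, d.base = b) → evalC val (concat b l).contribs3S = (l.map fun d => evalC val d.contribs3S).sum
  | [], _ => by simp [concat, contribs3S, evalC]
  | d :: l, h => by
    have hd : d.base = b := h d (by simp)
    have hl : ∀ d' ∈ l, d'.base = b := fun d' hd' => h d' (List.mem_cons_of_mem _ hd')
    have hcb := concat_base b l hl
    rw [List.map_cons, List.sum_cons, ← evalC_concat3 b val l hl, show concat b (d :: l) = d.append (concat b l) from rfl,
      evalC_appendS3 d (concat b l) (by rw [hcb, hd]) val]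

/-- The parts' values are the digests' values. -/
theorem map_evalC_of_digests3 (fuel : ℕ) (val : ℕ → ℝ) {l : List SymCert3} {D : List (List (ℕ × ℤ))}
    (hD : List.Forall₂ (fun d dg => d.digest3 fuel = dg) l D) : (l.map fun d => evalC val d.contribs3S) = D.map (evalC val) := by
  induction hD with
  | nil => rfl
  | cons hdg _ ih => rw [List.map_cons, List.map_cons, ih, ← hdg, evalC_digest3]

/-- **NONNEGATIVITY FROM DIGESTS:** if every part's digest is the stated list and the run check accepts the key-sorted concatenation of the stated
lists, the glued certificate's contribution list evaluates nonnegatively at every nonnegative key valuation. -/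
theorem pos_of_digests3 (b : Cert) (l : List SymCert3) (hb : ∀ d ∈ l, d.base = b) (fuel : ℕ) (D : List (List (ℕ × ℤ)))
    (hD : List.Forall₂ (fun d dg => d.digest3 fuel = dg) l D) (hruns : runsOK (msort2 fuel D.flatten) = true)
    (val : ℕ → ℝ) (hval : ∀ key, 0 ≤ val key) : 0 ≤ evalC val (concat b l).contribs3S := by
  rw [evalC_concat3 b val l hb, map_evalC_of_digests3 fuel val hD, ← evalC_flatten]
  exact evalC_nonneg_of_runsOK_msort2 val hval fuel _ hruns

section Count

open scoped Classical

/-- **«AT LEAST `h` OF `k` RELAYS CUT» FROM A DEGREE-3 CERTIFICATE CHECKED IN PARTS** (counting form): structure check of the glued certificate, the parts'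
digests, and the run check of the glued digests give `cD·μ(h ≤ #{v ∈ T : v ↮ a₀}) ≤ cN·δ`. [cite: VandenbergKahn2001, Thm 1.2 (p. 123)] -/
theorem cut_of_digests3_count {n k : ℕ} (b : Cert) (l : List SymCert3) (hb : ∀ d ∈ l, d.base = b) (hm : (concat b l).base.m = k)
    (hWS : (concat b l).checkW3S = true) (fuel : ℕ) (D : List (List (ℕ × ℤ))) (hD : List.Forall₂ (fun d dg => d.digest3 fuel = dg) l D)
    (hruns : runsOK (msort2 fuel D.flatten) = true)
    (w : Sym2 (Fin n) → unitInterval) (a₀ : Fin n) (T : Finset (Fin n)) (hT : T.card = k) (δ : ℝ) (hδ0 : 0 ≤ δ)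
    (hδ : ∀ v ∈ T, (Literature.Probability.LatticeModels.prodBernoulli w).real
      (Literature.Probability.Percolation.openConn v a₀ : Set (Literature.Probability.Percolation.BondConfig (Fin n)))ᶜ ≤ δ) :
    ((concat b l).base.cD : ℝ) * (Literature.Probability.LatticeModels.prodBernoulli w).real
        {ω : Literature.Probability.Percolation.BondConfig (Fin n) |
          (concat b l).base.h ≤ (T.filter fun v => ω ∉ Literature.Probability.Percolation.openConn v a₀).card} ≤ (concat b l).base.cN * δ :=
  (concat b l).cut_of_posS3_count hm hWS (pos_of_digests3 b l hb fuel D hD hruns) w a₀ T hT δ hδ0 hδ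

end Count

end SymCert3

/-! ### Smoke test: the `(2,1)` cubic certificate split into two parts -/

/-- First part: the multiplier and one marginal slack. -/
def sym3SmokeP1 : SymCert3 := ⟨⟨2, 1, 2, 1, 1, [], [], []⟩, [(4, 4, 1)], [(0, 4, 4, 1)], [], []⟩

/-- Second part: the other marginal slack. -/
def sym3SmokeP2 : SymCert3 := ⟨⟨2, 1, 2, 1, 1, [], [], []⟩, [], [(1, 4, 4, 1)], [], []⟩

/-- The glued digests pass the run check and the glued certificate is structurally sound. -/
theorem sym3Smoke_parts_ok : runsOK (msort2 8 [sym3SmokeP1.digest3 8, sym3SmokeP2.digest3 8].flatten) = true ∧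
    (SymCert3.concat ⟨2, 1, 2, 1, 1, [], [], []⟩ [sym3SmokeP1, sym3SmokeP2]).checkW3S = true := by
  constructor <;> decide +kernel

end QCert
end HubOnly

end Summit.CriticalPhenomena.PercolationContinuityZ3.Theorems
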